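import Literature.MathematicalPhysics.QuantumManyBody.BoseGasFreeDirichletBEC
import Literature.MathematicalPhysics.QuantumManyBody.JelliumOnsagerBound
import HarnessLib

/-!
# Crux `OneBodyEntropyBound` (stmt-AtomisticToContinuum-13440), line `registered`: stub `stub_freeEnergyBound`

Route `BECCellInformation`, problem `BoseEinsteinCondensation` of the summit `AtomisticToContinuum`;
support file for the line's skeleton (namespace `…Cruxes.OneBodyEntropyBound.Birth`).

**Statement** (`stub_freeEnergyBound`): for a radial pair potential `v : ℝ → ℝ≥0∞` vanishing on
`(0, ∞)` there is `C ≥ 0` with `E₀(v, N, L) ≤ C N / L²` for every particle number `N` and every box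
side `L > 0` — the free Dirichlet gas bound, `C = 𝓔₀[β]` the kinetic energy of the unit bump of
`BoseGasCatStates`.

**Proof.**
1. The coincidence planes `{X | xᵢ = xⱼ}` (`i ≠ j`) are Lebesgue-null in `(ℝ³)^N`
   (`JelliumBoseGas.ae_injective`, tree file `JelliumOnsagerBound`), and off them every pair
   distance is `> 0`, so the interaction `∑_{i<j} v(|xᵢ − xⱼ|)` of a potential vanishing on
   `(0, ∞)` is `0` almost everywhere (`interaction_ae_eq_zero_of_pos`);
2. hence `energy v Ψ = energy 0 Ψ` for every trial state (`lintegral_congr_ae`) and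
   `E₀(v, N, L) = E₀(0, N, L)` (`groundStateEnergy_eq_groundStateEnergy_zero_of_pos`);
3. the tree's `groundStateEnergy_zero_le`: `E₀(0, N, L) ≤ (L²)⁻¹ · N · 𝓔₀[β]` with
   `𝓔₀[β] = energy 0 unitBump = ofReal C` (`energy_unitBump_eq_ofReal`), and
   `ofReal (L²)⁻¹ * (N * ofReal C) = ofReal (C / L² * N)`.
The case `N = 0` needs no special treatment (both sides are `0`).
-/

noncomputable section

namespace Summit.AtomisticToContinuum.BoseEinsteinCondensation.Cruxes.OneBodyEntropyBound.Birth

open MeasureTheory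
open scoped ENNReal
open Literature.MathematicalPhysics.QuantumManyBody.BoseGas

/-- On a configuration with pairwise distinct particles, the interaction of a potential vanishing
on `(0, ∞)` is zero: every pair distance `|xᵢ − xⱼ|`, `i < j`, is positive. [folklore] -/
theorem interaction_eq_zero_of_injective {N : ℕ} {v : ℝ → ℝ≥0∞}
    (hv : ∀ r : ℝ, 0 < r → v r = 0) {X : Config N} (hX : Function.Injective X) :
    interaction v X = 0 := by
  refine Finset.sum_eq_zero fun i _ => Finset.sum_eq_zero fun j hj => ?_
  exact hv _ (dist_pos.2 (hX.ne (Finset.mem_filter.1 hj).2.ne))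

/-- The interaction of a potential vanishing on `(0, ∞)` vanishes for almost every configuration
(the coincidence planes `{xᵢ = xⱼ}`, `i ≠ j`, are Lebesgue-null). [folklore] -/
theorem interaction_ae_eq_zero_of_pos (N : ℕ) {v : ℝ → ℝ≥0∞}
    (hv : ∀ r : ℝ, 0 < r → v r = 0) : ∀ᵐ X : Config N, interaction v X = 0 := by
  filter_upwards [Literature.MathematicalPhysics.QuantumManyBody.JelliumBoseGas.ae_injective N]
    with X hX
  exact interaction_eq_zero_of_injective hv hX

/-- **A potential vanishing on `(0, ∞)` is the free gas**: `energy v Ψ = energy 0 Ψ` for every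
trial state (the integrands agree off the null coincidence set). [folklore] -/
theorem energy_eq_energy_zero_of_pos {N : ℕ} {L : ℝ} {v : ℝ → ℝ≥0∞}
    (hv : ∀ r : ℝ, 0 < r → v r = 0) (Ψ : TrialState N L) : energy v Ψ = energy 0 Ψ := by
  unfold energy
  refine lintegral_congr_ae ?_
  filter_upwards [interaction_ae_eq_zero_of_pos N hv] with X hX
  rw [hX, interaction_zeroPotential]

/-- … hence the ground-state energies agree: `E₀(v, N, L) = E₀(0, N, L)`. [folklore] -/
theorem groundStateEnergy_eq_groundStateEnergy_zero_of_pos {v : ℝ → ℝ≥0∞}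
    (hv : ∀ r : ℝ, 0 < r → v r = 0) (N : ℕ) (L : ℝ) :
    groundStateEnergy v N L = groundStateEnergy 0 N L := by
  unfold groundStateEnergy
  exact iInf_congr fun Ψ => energy_eq_energy_zero_of_pos hv Ψ

/-- **Stub `stub_freeEnergyBound` (free-gas energy bound).** For a radial pair potential vanishing on
`(0, ∞)` the Dirichlet ground-state energy of `N` bosons in `Λ_L` satisfies `E₀(v, N, L) ≤ C N / L²`
for all `N` and all `L > 0`, with `C = 𝓔₀[β] ≥ 0` the free energy of the unit bump: the interaction
is invisible (`groundStateEnergy_eq_groundStateEnergy_zero_of_pos`) and the free gas is bounded by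
the dilated power state (`groundStateEnergy_zero_le`). [folklore] -/
theorem stub_freeEnergyBound :
    ∀ v : ℝ → ENNReal, (∀ r : ℝ, 0 < r → v r = 0) → ∃ C : ℝ, 0 ≤ C ∧ ∀ (N : ℕ) (L : ℝ), 0 < L →
      Literature.MathematicalPhysics.QuantumManyBody.BoseGas.groundStateEnergy v N L ≤
      ENNReal.ofReal (C / L ^ 2 * N) := by
  intro v hv
  set C : ℝ := (energy 0 unitBump).toReal
  have hE : energy 0 unitBump = ENNReal.ofReal C := energy_unitBump_eq_ofReal
  refine ⟨C, ENNReal.toReal_nonneg, fun N L hL => ?_⟩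
  rw [groundStateEnergy_eq_groundStateEnergy_zero_of_pos hv]
  refine (groundStateEnergy_zero_le hL N).trans_eq ?_
  rw [hE, ← ENNReal.ofReal_natCast, ← ENNReal.ofReal_mul (Nat.cast_nonneg N),
    ← ENNReal.ofReal_mul (inv_nonneg.2 (sq_nonneg L))]
  congr 1
  ring

end Summit.AtomisticToContinuum.BoseEinsteinCondensation.Cruxes.OneBodyEntropyBound.Birth

end
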